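import Summits.HodgeConjecture.HodgeConjecture.Theorems.HLiu418S1BettiSliceLines
import Summits.HodgeConjecture.HodgeConjecture.Theorems.HLiu418CurveHodgeTypesDisjoint
import Summits.HodgeConjecture.HodgeConjecture.Theorems.F0P3HJ3aAssembly
import Literature.NumberTheory.Automorphic.UnitaryCurveCotangentSpectralProjectionConj
import Literature.NumberTheory.Automorphic.UnitaryCurveCohCotangentFormsConjRep   -- ed. 2: ★ p798131 (A-p06 (g18)), E1′₂a ⇐ E1′₂h and E₂a ⇐ E₂h by conjugation
import HarnessLib

/-!
# Crux `HLiu418`, line `F0_AlbCm` ∕ sub-sub-line `F0_AlbCmS1Betti` — HEAD: `stub_S1_multOneForms : S1MultOneFormsShape` MODULO EXACTLY THE EIGHT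
# PRINTED-CITATION LETTERS (the `n = 2` twin of ★ `F0P3HJ3aAssembly.hJ3a_of_S345` ∕ ★ `HJ3aOfLetters.hJ3a_of_letters`)

Floor-0 programme P5 (Alb-CM), seat F0P5-p03 (g0) (B2 seat 2, the `n = 2` slice of `stub_S1_betti : S1BettiShape`); crux item stmt-HodgeConjecture-24832
(`HCCMUnconditional.HLiu418`); sub-sub-line `Cruxes/HLiu418/Lines/F0_AlbCmS1Betti.lean` (F0P5-p01 (g0); ed. 2: stubs `stub_S1_levelRealisation`,
`stub_S1_multOneForms : S1MultOneFormsShape`; junction `s1BettiShape_of : S1RealisationShape → S1MultOneFormsShape → S1BettiShape`).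
HC_CM is proved only modulo the 7 printed citations until rung 0 closes; this file is `sorry`-free and DEF-free and takes the printed-citation letters as
HYPOTHESES.

WHAT IS PROVED.  `s1MultOneForms_of_letters`: the statement of `S1MultOneFormsShape` («the `ω⋆_lab`-equivariant maps into the coherent `1`-forms
`cohForms₂ 𝔣 = holCotForms₂ 𝔣 ⊔ conj (holCotForms₂ 𝔣)` of the curve `U(J⋆)` lie on ONE line», [Liu2021, Prop. D.4 (1)]) — conclusion TOKEN FOR TOKEN the
body of the tree's `S1MultOneFormsShape` (ed. 2, binder prefix with `h4`) — from the eight ★ letters E1₂ `Rogawski1990.curveMultiplicityLeOne`, E1′₂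
`curveCohFinComponentUnique_hol ∕ _antihol`, E2′₂θ `curveThetaHodgeTypeRigid`, D₂ `UnitaryCurveForms.holCotFormSpectralProjection₂ ∕ antihol…`, E₂
`UnitaryCurveForms.cohIsotypicLine₂_hol ∕ _antihol` and NOTHING ELSE; `s1MultOneForms_of_seven_letters`: the same from SEVEN letters, D₂⁻ being derived
from D₂⁺ by ★ `UnitaryCurveForms.antiholCotFormSpectralProjection₂_of_hol` (A-p06 (g18), p797687).  ED. 2 (append):
`s1MultOneForms_of_five_letters`: the same from FIVE letters {E1₂, E1′₂h, E2′₂θ, D₂h, E₂h}, the three (0,1)-type letters being the conjugates of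
their (1,0) twins (★ `curveCohFinComponentUnique_antihol_of_hol`, ★ `cohIsotypicLine₂_antihol_of_hol`, A-p06 (g18), p798131) — the `n = 2` twin of ★
`F0P3HJ3aOfFiveLetters`.

COMPOSITION (kernel-checked, no hole): binder by binder, `exists_line_of_split` (the LINE form of ★ `F0P3HJ3aAssembly.rank_intertwiningMap_le_one_of_split`:
an intertwiner valued in `A ⊔ B`, `A`, `B` disjoint and `G`-stable, splits as `ψ_A + ψ_B` with equivariant components — `exists_intertwiningMap_split` —
so if the `A`-valued and the `B`-valued intertwiners each lie on a line and one family vanishes, the `(A ⊔ B)`-valued ones lie on a line) at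
`A = holCotForms₂ 𝔣`, `B = A.map conjFun₂`, `R = rightRep₂`, fed with (D) ★ `CurveHodgeTypesDisjoint.hodgeTypes₂_disjoint_stable` (disjointness and
stability of the two Hodge types, hermitianity of `J⋆` at the place of `ι₁` by ★ `isHermitian_map_of_formCongr`), (L10)∕(L01) ★
`S1BettiSliceLines.stub_L10_of_letters hE1 hE1'h hDh hEh` ∕ `stub_L01_of_letters hE1 hE1'a hDa hEa`, and (X) ★ `S1BettiSliceExclusion.stub_X_of_letters
hE2' hDh hDa`.

USE (edition hunk for the registrar of `Lines/F0_AlbCmS1Betti.lean`): `import Summits.HodgeConjecture.HodgeConjecture.Theorems.HLiu418S1MultOneFormsOfLetters`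
and either `theorem s1MultOneForms_of_letters (hE1 …) … (hEa …) : S1MultOneFormsShape := S1MultOneFormsOfLetters.s1MultOneForms_of_letters hE1 hE1'h hE1'a
hE2' hDh hDa hEh hEa` (head style, as `F0_U3CohMultOne` v1.4) or, with the letters carried as named-fact stubs (as `F0_AlbCmS1bHodge` ed. 2),
`theorem stub_S1_multOneForms : S1MultOneFormsShape := S1MultOneFormsOfLetters.s1MultOneForms_of_letters stub_E1 stub_E1'h stub_E1'a stub_E2' stub_Dh
stub_Da stub_Eh stub_Ea`; then `S1BettiShape` follows by the line's own `s1BettiShape_of stub_S1_realisation ‹that›`.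

References: [Liu2021] Camb. J. Math. 9 (2021), Prop. D.4 (1) and proof p. 130–131, §D.2–§D.3; [Rogawski1990] Ann. of Math. Stud. 123, §11, §12.3,
Thm. 13.3.5∕13.3.7; [BorelJacquet1979] §4.6; [BorelWallach2000] VII 2.10, 3.2, 3.6.
-/

set_option autoImplicit false
-- the mandated namespace repeats `HodgeConjecture.HodgeConjecture`, as in every `Theorems/*.lean` of this sub-problem
set_option linter.dupNamespace false

noncomputable section

namespace Summit.HodgeConjecture.HodgeConjecture.Cruxes.HLiu418.S1MultOneFormsOfLetters

open scoped TensorProduct Matrix NumberField Kronecker ComplexOrder InnerProductSpace ENNReal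
open MeasureTheory
open NumberField NumberField.InfinitePlace IsDedekindDomain
open Summit.HodgeConjecture.CorCM.Model Summit.HodgeConjecture.CorCM.Model.HComp Summit.HodgeConjecture.CorCM.HComp
open Literature.AlgebraicGeometry.Motives (CMType AbelianVariety)
open Literature.AlgebraicGeometry.ShimuraVarieties Literature.AlgebraicGeometry.ShimuraVarieties.UnitaryCanonicalModel
open Literature.NumberTheory.Automorphic Literature.NumberTheory.Automorphic.UnitaryGroup Literature.NumberTheory.Automorphic.UnitaryCurveForms
open Literature.NumberTheory.Automorphic.UnitaryGroup.CotangentForms (toQuotFun toQuotFun_mk)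
open Literature.NumberTheory.Automorphic.IdeleClassGroup Literature.NumberTheory.Automorphic.Liu2021 Literature.NumberTheory.Automorphic.Liu2021.AppendixC
open Literature.NumberTheory.GaloisRepresentations Literature.RepresentationTheory.Liu2021 Literature.RepresentationTheory.HarrisKudlaSweet1996
open Literature.AlgebraicGeometry.Liu2021 (IsAdmissibleElement)
open Literature.NumberTheory.Weil1964 Literature.NumberTheory.GelbartRogawski1991 Literature.NumberTheory.GelbartRogawski1991.UnitaryDualPair Literature.NumberTheory.GelbartRogawski1991.UnitaryDualPair.WeilCoinv
open Literature.NumberTheory.GelbartRogawski1991.UnitaryDualPair.LocalSplitting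
open Literature.NumberTheory.Automorphic.Liu2021.Def411WeilCarriersDoubling
open Literature.NumberTheory.Automorphic.Liu2021.Def411WeilCarriers (TW JW JW_eq isSymm_TW isUnit_det_TW Rep Eps epsOf Chi rhoVAtLine rhoAtLine omegaAtLine)
open Summit.HodgeConjecture.CorCM (CMField)
open Summit.HodgeConjecture.CorCM.Lines.A3Liu418
open Summit.HodgeConjecture.HodgeConjecture.Cruxes.H413.F0P3HilbertProjection
open Summit.HodgeConjecture.HodgeConjecture.Cruxes.H413.SpectrumJunction
open Summit.HodgeConjecture.HodgeConjecture.Cruxes.HLiu418.ScalarSpectralJunction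
open Summit.HodgeConjecture.HodgeConjecture.Cruxes.HLiu418.IntertwiningLineOfLetters
open Summit.HodgeConjecture.HodgeConjecture.Cruxes.HLiu418
open Summit.HodgeConjecture.HodgeConjecture.Cruxes.H413.F0P3HJ3aAssembly (left_eq_of_add_eq_add_of_disjoint right_eq_of_add_eq_add_of_disjoint)

/-! ## §1 The LINE form of the splitting algebra (generic; the rank form is ★ `F0P3HJ3aAssembly.rank_intertwiningMap_le_one_of_split`) -/

section Split

universe u

variable {k G : Type*} {W X : Type u} [Field k] [Monoid G] [AddCommGroup W] [Module k W] [AddCommGroup X] [Module k X]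

/-- **Splitting an intertwiner along a disjoint `G`-stable pair.**  If `A`, `B ≤ X` are disjoint and stable under `R`, every intertwiner
`ψ : ρ → R` with values in `A ⊔ B` is `ψ_A + ψ_B` with intertwiners `ψ_A`, `ψ_B` valued in `A` resp. `B` (the projections along `A ⊕ B`, which are
equivariant by uniqueness of the decomposition, ★ `left_eq_of_add_eq_add_of_disjoint`). [folklore] -/
theorem exists_intertwiningMap_split (ρ : Representation k G W) (R : Representation k G X) (A B : Submodule k X)
    (hAB : Disjoint A B) (hA : ∀ (g : G) (x : X), x ∈ A → R g x ∈ A) (hB : ∀ (g : G) (x : X), x ∈ B → R g x ∈ B)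
    (ψ : ρ.IntertwiningMap R) (hψ : ∀ w, ψ w ∈ A ⊔ B) :
    ∃ ψA ψB : ρ.IntertwiningMap R, (∀ w, ψA w ∈ A) ∧ (∀ w, ψB w ∈ B) ∧ ψ = ψA + ψB := by
  -- the sum map `A × B → X` is injective with range `A ⊔ B`
  let cop : (↥A × ↥B) →ₗ[k] X := A.subtype.coprod B.subtype
  have hcop_apply : ∀ p : ↥A × ↥B, cop p = (p.1 : X) + (p.2 : X) := fun p => by
    simp only [cop, LinearMap.coprod_apply, Submodule.subtype_apply]
  have hcop_inj : Function.Injective cop := by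
    rw [← LinearMap.ker_eq_bot, LinearMap.ker_eq_bot']
    rintro ⟨a, b⟩ hab
    rw [hcop_apply] at hab
    have hab' : (a : X) + b = 0 + 0 := by simpa using hab
    have ha0 : (a : X) = 0 := left_eq_of_add_eq_add_of_disjoint hAB a.2 A.zero_mem b.2 B.zero_mem hab'
    have hb0 : (b : X) = 0 := right_eq_of_add_eq_add_of_disjoint hAB a.2 A.zero_mem b.2 B.zero_mem hab'
    ext
    · simpa using ha0
    · simpa using hb0
  have hrange : LinearMap.range cop = A ⊔ B := by
    simp only [cop, LinearMap.range_coprod, Submodule.range_subtype]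
  let e : (↥A × ↥B) ≃ₗ[k] ↥(LinearMap.range cop) := LinearEquiv.ofInjective cop hcop_inj
  have hval : ∀ w, ψ.toLinearMap w ∈ LinearMap.range cop := fun w => by rw [hrange]; exact hψ w
  -- the two components
  let comp : W →ₗ[k] (↥A × ↥B) :=
    (e.symm : ↥(LinearMap.range cop) →ₗ[k] (↥A × ↥B)) ∘ₗ LinearMap.codRestrict (LinearMap.range cop) ψ.toLinearMap hval
  let fA : W →ₗ[k] X := A.subtype ∘ₗ LinearMap.fst k ↥A ↥B ∘ₗ comp
  let fB : W →ₗ[k] X := B.subtype ∘ₗ LinearMap.snd k ↥A ↥B ∘ₗ comp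
  have hmemA : ∀ w, fA w ∈ A := fun w => ((comp w).1).2
  have hmemB : ∀ w, fB w ∈ B := fun w => ((comp w).2).2
  have hsum : ∀ w, fA w + fB w = ψ w := by
    intro w
    have h1 : cop (comp w) = ψ w := by
      have h2 := congrArg Subtype.val (e.apply_symm_apply (LinearMap.codRestrict (LinearMap.range cop) ψ.toLinearMap hval w))
      rw [LinearEquiv.ofInjective_apply] at h2
      exact h2
    calc fA w + fB w = ((comp w).1 : X) + ((comp w).2 : X) := rfl
      _ = cop (comp w) := (hcop_apply _).symm
      _ = ψ w := h1
  have heqvA : ∀ (g : G) (w : W), fA (ρ g w) = R g (fA w) := by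
    intro g w
    have h := hsum (ρ g w)
    rw [Representation.IntertwiningMap.isIntertwining ρ R ψ g w, ← hsum w, map_add] at h
    exact left_eq_of_add_eq_add_of_disjoint hAB (hmemA _) (hA g _ (hmemA w)) (hmemB _) (hB g _ (hmemB w)) h
  have heqvB : ∀ (g : G) (w : W), fB (ρ g w) = R g (fB w) := by
    intro g w
    have h := hsum (ρ g w)
    rw [Representation.IntertwiningMap.isIntertwining ρ R ψ g w, ← hsum w, map_add] at h
    exact right_eq_of_add_eq_add_of_disjoint hAB (hmemA _) (hA g _ (hmemA w)) (hmemB _) (hB g _ (hmemB w)) h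
  refine ⟨fA.intertwiningMap_of_isIntertwiningMap ρ R heqvA, fB.intertwiningMap_of_isIntertwiningMap ρ R heqvB, hmemA, hmemB, ?_⟩
  apply Representation.IntertwiningMap.ext
  apply LinearMap.ext
  intro w
  exact (hsum w).symm

/-- **The LINE form of the splitting algebra.**  If the `A`-valued intertwiners `ρ → R` lie on a line, the `B`-valued ones lie on a line, and one of
the two families vanishes identically, then the `(A ⊔ B)`-valued intertwiners lie on a line (`A`, `B` disjoint and `G`-stable).  [folklore] -/
theorem exists_line_of_split (ρ : Representation k G W) (R : Representation k G X) (A B : Submodule k X)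
    (hAB : Disjoint A B) (hA : ∀ (g : G) (x : X), x ∈ A → R g x ∈ A) (hB : ∀ (g : G) (x : X), x ∈ B → R g x ∈ B)
    (hL10 : ∃ ψ₀ : ρ.IntertwiningMap R, ∀ ψ : ρ.IntertwiningMap R, (∀ w, ψ w ∈ A) → ∃ a : k, ψ = a • ψ₀)
    (hL01 : ∃ ψ₀ : ρ.IntertwiningMap R, ∀ ψ : ρ.IntertwiningMap R, (∀ w, ψ w ∈ B) → ∃ a : k, ψ = a • ψ₀)
    (hX : (∀ ψ : ρ.IntertwiningMap R, (∀ w, ψ w ∈ A) → ψ = 0) ∨ (∀ ψ : ρ.IntertwiningMap R, (∀ w, ψ w ∈ B) → ψ = 0)) :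
    ∃ ψ₀ : ρ.IntertwiningMap R, ∀ ψ : ρ.IntertwiningMap R, (∀ w, ψ w ∈ A ⊔ B) → ∃ a : k, ψ = a • ψ₀ := by
  rcases hX with h0 | h0
  · obtain ⟨ψ₀, hψ₀⟩ := hL01
    refine ⟨ψ₀, fun ψ hψ => ?_⟩
    obtain ⟨ψA, ψB, hmA, hmB, rfl⟩ := exists_intertwiningMap_split ρ R A B hAB hA hB ψ hψ
    obtain ⟨a, ha⟩ := hψ₀ ψB hmB
    exact ⟨a, by rw [h0 ψA hmA, zero_add, ha]⟩
  · obtain ⟨ψ₀, hψ₀⟩ := hL10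
    refine ⟨ψ₀, fun ψ hψ => ?_⟩
    obtain ⟨ψA, ψB, hmA, hmB, rfl⟩ := exists_intertwiningMap_split ρ R A B hAB hA hB ψ hψ
    obtain ⟨a, ha⟩ := hψ₀ ψA hmA
    exact ⟨a, by rw [h0 ψB hmB, add_zero, ha]⟩

end Split

/-! ## §2 The head: `S1MultOneFormsShape` from the eight letters (and from seven) -/

set_option synthInstance.maxHeartbeats 400000 in
set_option maxHeartbeats 4000000 in
/-- **HEAD — `S1MultOneFormsShape` MODULO EXACTLY THE EIGHT PRINTED-CITATION LETTERS, BY NAME.**  From E1₂ (`curveMultiplicityLeOne`), E1′₂h∕a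
(`curveCohFinComponentUnique_hol ∕ _antihol`), E2′₂θ (`curveThetaHodgeTypeRigid`), D₂h∕a (`holCotFormSpectralProjection₂ ∕ antihol…`), E₂h∕a
(`cohIsotypicLine₂_hol ∕ _antihol`) and NOTHING ELSE: the `ω⋆_lab`-equivariant maps into the coherent curve `1`-forms `cohForms₂ 𝔣` lie on one line.
Conclusion = the body of the sub-sub-line's `S1MultOneFormsShape` (ed. 2) TOKEN FOR TOKEN; composition `exists_line_of_split` of (D) ★
`CurveHodgeTypesDisjoint.hodgeTypes₂_disjoint_stable`, (L10)∕(L01) ★ `S1BettiSliceLines.stub_L10_of_letters ∕ stub_L01_of_letters`, (X) ★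
`S1BettiSliceExclusion.stub_X_of_letters`.  HC_CM is proved only modulo the 7 printed citations until rung 0 closes.
[cite: Liu2021, Prop. D.4 (1) and proof (p. 130–131)] [cite: Rogawski1990, §11.1 Prop. 11.1.1; Thm. 11.5.1; §12.3; Thm. 13.3.5 and 13.3.7]
[cite: BorelJacquet1979, §4.6] [cite: BorelWallach2000, VII 3.2 and 3.6] -/
theorem s1MultOneForms_of_letters (hE1 : Literature.NumberTheory.Rogawski1990.curveMultiplicityLeOne)
    (hE1'h : Literature.NumberTheory.Rogawski1990.curveCohFinComponentUnique_hol)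
    (hE1'a : Literature.NumberTheory.Rogawski1990.curveCohFinComponentUnique_antihol)
    (hE2' : Literature.NumberTheory.Rogawski1990.curveThetaHodgeTypeRigid)
    (hDh : Literature.NumberTheory.Automorphic.UnitaryCurveForms.holCotFormSpectralProjection₂)
    (hDa : Literature.NumberTheory.Automorphic.UnitaryCurveForms.antiholCotFormSpectralProjection₂)
    (hEh : Literature.NumberTheory.Automorphic.UnitaryCurveForms.cohIsotypicLine₂_hol)
    (hEa : Literature.NumberTheory.Automorphic.UnitaryCurveForms.cohIsotypicLine₂_antihol) :
      ∀ (F : CMField) [IsGalois ℚ F] (ι₁ : F →+* ℂ)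
        (μ : Literature.NumberTheory.Automorphic.IdeleClassGroup (F : Type) →ₜ* Circle)
        (hμ : IdeleClassGroup.IsConjugateSymplectic (F : Type) μ)
        (_hw : IdeleClassGroup.HasWeight (F : Type) μ 1)
        (Jstar : Matrix (Fin 2) (Fin 2) (F : Type)) (t : (F : Type)) (ht : t ≠ 0) (_hτt : 0 < (ι₁ t).re) (_hτt' : (ι₁ t).im = 0)
        (gstar : GL (Fin 2) (F : Type))
        (dJ : Fin 2 → (F : Type)) (hdJ : ∀ i, IsCMField.complexConj (F : Type) (dJ i) = dJ i) (hdJ0 : ∀ i, dJ i ≠ 0)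
        (hg : formCongr ((IsCMField.complexConj (F : Type) : (F : Type) ≃ₐ[↥(maximalRealSubfield (F : Type))] (F : Type)) :
            (F : Type) →+* (F : Type)) gstar (t • Jstar) = Matrix.diagonal dJ)
        (_hsig : (∃ Tstar : GL (Fin 2) ℂ,
            formCongr (starRingEnd ℂ) Tstar ((Matrix.diagonal dJ).map ι₁) = Matrix.diagonal ![(1 : ℂ), -1]) ∧
          ∀ τ' : (F : Type) →+* ℂ, InfinitePlace.mk τ' ≠ InfinitePlace.mk ι₁ → ((Matrix.diagonal dJ).map τ').PosDef)
        (h4 : 4 ≤ Module.finrank ℚ (F : Type))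
        (r : Rep ↥(maximalRealSubfield (F : Type)) (imagUnitSq F))
        (ε : Eps ↥(maximalRealSubfield (F : Type)) (imagUnitSq F))
        (_hadm : ∃ e : (F : Type), IsAdmissibleElement (F : Type) hμ.cmType.1 e ∧
          epsOf ↥(maximalRealSubfield (F : Type)) (imagUnitSq F) (F : Type) (2 * imagUnit (F : Type))⁻¹ (-e) = ε)
        (χ : Chi ↥(maximalRealSubfield (F : Type)) (F : Type) (IsCMField.complexConj (F : Type)))
        (𝔣 : ConeFrame (F : Type) Jstar (cmPlace (F : Type) ι₁)),
        ∃ ψ₀ : Representation.IntertwiningMap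
            ((rhoVAtLine ↥(maximalRealSubfield (F : Type)) (F : Type) (IsCMField.complexConj (F : Type)) 2
              (finProdFinEquiv : Fin 2 × Fin 1 ≃ Fin (2 * 1)) (Matrix.diagonal dJ)
              (complexConj_imagUnit F) (imagUnit_ne_zero F) (imagUnit_mul_self F) (realDiagonal_isSymm F dJ hdJ)
              (isUnit_det_realDiagonal F dJ hdJ hdJ0) (realDiagonal_map F dJ hdJ).symm
              (hsChiGS F finProdFinEquiv dJ hdJ hdJ0
                (toHeckeCharacter (F : Type) (galConj (IsCMField.complexConj (F : Type)) μ))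
                (isUnitary_toHeckeCharacter (F : Type) (galConj (IsCMField.complexConj (F : Type)) μ))
                ((isOscillatorChar_toHeckeCharacter_iff (galConj (IsCMField.complexConj (F : Type)) μ)).mpr hμ.galConj))
              (r.toFun ε) χ).comp
              (finAdelicCongr ↥(maximalRealSubfield (F : Type)) (F : Type) (IsCMField.complexConj (F : Type)) gstar ht hg).symm.toMonoidHom)
            (rightRep₂ ↥(maximalRealSubfield (F : Type)) (F : Type) (IsCMField.complexConj (F : Type)) Jstar),
          ∀ ψ : Representation.IntertwiningMap
            ((rhoVAtLine ↥(maximalRealSubfield (F : Type)) (F : Type) (IsCMField.complexConj (F : Type)) 2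
              (finProdFinEquiv : Fin 2 × Fin 1 ≃ Fin (2 * 1)) (Matrix.diagonal dJ)
              (complexConj_imagUnit F) (imagUnit_ne_zero F) (imagUnit_mul_self F) (realDiagonal_isSymm F dJ hdJ)
              (isUnit_det_realDiagonal F dJ hdJ hdJ0) (realDiagonal_map F dJ hdJ).symm
              (hsChiGS F finProdFinEquiv dJ hdJ hdJ0
                (toHeckeCharacter (F : Type) (galConj (IsCMField.complexConj (F : Type)) μ))
                (isUnitary_toHeckeCharacter (F : Type) (galConj (IsCMField.complexConj (F : Type)) μ))
                ((isOscillatorChar_toHeckeCharacter_iff (galConj (IsCMField.complexConj (F : Type)) μ)).mpr hμ.galConj))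
              (r.toFun ε) χ).comp
              (finAdelicCongr ↥(maximalRealSubfield (F : Type)) (F : Type) (IsCMField.complexConj (F : Type)) gstar ht hg).symm.toMonoidHom)
            (rightRep₂ ↥(maximalRealSubfield (F : Type)) (F : Type) (IsCMField.complexConj (F : Type)) Jstar),
          (∀ w, ψ w ∈ cohForms₂ ↥(maximalRealSubfield (F : Type)) (F : Type) (IsCMField.complexConj (F : Type)) Jstar
              (IsCMField.complexConj_ne_one (F : Type)) (UnitaryGroup.complexConj_smul_infinitePlace (F : Type))
              (cmPlace (F : Type) ι₁) 𝔣) → ∃ a : ℂ, ψ = a • ψ₀ := by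
  intro F _ ι₁ μ hμ hw Jstar t ht hτt hτt' gstar dJ hdJ hdJ0 hg hsig h4 r ε hadm χ 𝔣
  obtain ⟨hAB, hA, hB⟩ := CurveHodgeTypesDisjoint.hodgeTypes₂_disjoint_stable ↥(maximalRealSubfield (F : Type)) (F : Type)
    (IsCMField.complexConj (F : Type)) Jstar (IsCMField.complexConj_ne_one (F : Type)) (UnitaryGroup.complexConj_smul_infinitePlace (F : Type))
    (cmPlace (F : Type) ι₁) (CurveHodgeTypesDisjoint.isHermitian_map_of_formCongr (F : Type) ι₁ Jstar t ht hτt' gstar dJ hdJ hg _) 𝔣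
  exact exists_line_of_split _ _ _ _ hAB hA hB
    (S1BettiSliceLines.stub_L10_of_letters hE1 hE1'h hDh hEh F ι₁ μ hμ hw Jstar t ht hτt hτt' gstar dJ hdJ hdJ0 hg hsig h4 r ε hadm χ 𝔣)
    (S1BettiSliceLines.stub_L01_of_letters hE1 hE1'a hDa hEa F ι₁ μ hμ hw Jstar t ht hτt hτt' gstar dJ hdJ hdJ0 hg hsig h4 r ε hadm χ 𝔣)
    (S1BettiSliceExclusion.stub_X_of_letters hE2' hDh hDa F ι₁ μ hμ hw Jstar t ht hτt hτt' gstar dJ hdJ hdJ0 hg hsig h4 r ε hadm χ 𝔣)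

set_option synthInstance.maxHeartbeats 400000 in
set_option maxHeartbeats 4000000 in
/-- **HEAD′ — `S1MultOneFormsShape` MODULO SEVEN LETTERS {E1₂, E1′₂h, E1′₂a, E2′₂θ, D₂h, E₂h, E₂a}**: the (0,1)-type spectral projection letter D₂a
is the conjugate of D₂h by ★ `UnitaryCurveForms.antiholCotFormSpectralProjection₂_of_hol` (A-p06 (g18), p797687; the rank-2 twin of ★
`UnitaryGroupCotangentSpectralProjectionConj`).  Same conclusion, token for token.  HC_CM is proved only modulo the 7 printed citations until rung 0 closes.
[cite: Liu2021, Prop. D.4 (1) and proof (p. 130–131)] [cite: Rogawski1990, §11.1 Prop. 11.1.1; Thm. 11.5.1; §12.3] [cite: BorelJacquet1979, §4.6]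
[cite: BorelWallach2000, VII 3.2 and 3.6] -/
theorem s1MultOneForms_of_seven_letters (hE1 : Literature.NumberTheory.Rogawski1990.curveMultiplicityLeOne)
    (hE1'h : Literature.NumberTheory.Rogawski1990.curveCohFinComponentUnique_hol)
    (hE1'a : Literature.NumberTheory.Rogawski1990.curveCohFinComponentUnique_antihol)
    (hE2' : Literature.NumberTheory.Rogawski1990.curveThetaHodgeTypeRigid)
    (hDh : Literature.NumberTheory.Automorphic.UnitaryCurveForms.holCotFormSpectralProjection₂)
    (hEh : Literature.NumberTheory.Automorphic.UnitaryCurveForms.cohIsotypicLine₂_hol)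
    (hEa : Literature.NumberTheory.Automorphic.UnitaryCurveForms.cohIsotypicLine₂_antihol) :
      ∀ (F : CMField) [IsGalois ℚ F] (ι₁ : F →+* ℂ)
        (μ : Literature.NumberTheory.Automorphic.IdeleClassGroup (F : Type) →ₜ* Circle)
        (hμ : IdeleClassGroup.IsConjugateSymplectic (F : Type) μ)
        (_hw : IdeleClassGroup.HasWeight (F : Type) μ 1)
        (Jstar : Matrix (Fin 2) (Fin 2) (F : Type)) (t : (F : Type)) (ht : t ≠ 0) (_hτt : 0 < (ι₁ t).re) (_hτt' : (ι₁ t).im = 0)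
        (gstar : GL (Fin 2) (F : Type))
        (dJ : Fin 2 → (F : Type)) (hdJ : ∀ i, IsCMField.complexConj (F : Type) (dJ i) = dJ i) (hdJ0 : ∀ i, dJ i ≠ 0)
        (hg : formCongr ((IsCMField.complexConj (F : Type) : (F : Type) ≃ₐ[↥(maximalRealSubfield (F : Type))] (F : Type)) :
            (F : Type) →+* (F : Type)) gstar (t • Jstar) = Matrix.diagonal dJ)
        (_hsig : (∃ Tstar : GL (Fin 2) ℂ,
            formCongr (starRingEnd ℂ) Tstar ((Matrix.diagonal dJ).map ι₁) = Matrix.diagonal ![(1 : ℂ), -1]) ∧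
          ∀ τ' : (F : Type) →+* ℂ, InfinitePlace.mk τ' ≠ InfinitePlace.mk ι₁ → ((Matrix.diagonal dJ).map τ').PosDef)
        (h4 : 4 ≤ Module.finrank ℚ (F : Type))
        (r : Rep ↥(maximalRealSubfield (F : Type)) (imagUnitSq F))
        (ε : Eps ↥(maximalRealSubfield (F : Type)) (imagUnitSq F))
        (_hadm : ∃ e : (F : Type), IsAdmissibleElement (F : Type) hμ.cmType.1 e ∧
          epsOf ↥(maximalRealSubfield (F : Type)) (imagUnitSq F) (F : Type) (2 * imagUnit (F : Type))⁻¹ (-e) = ε)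
        (χ : Chi ↥(maximalRealSubfield (F : Type)) (F : Type) (IsCMField.complexConj (F : Type)))
        (𝔣 : ConeFrame (F : Type) Jstar (cmPlace (F : Type) ι₁)),
        ∃ ψ₀ : Representation.IntertwiningMap
            ((rhoVAtLine ↥(maximalRealSubfield (F : Type)) (F : Type) (IsCMField.complexConj (F : Type)) 2
              (finProdFinEquiv : Fin 2 × Fin 1 ≃ Fin (2 * 1)) (Matrix.diagonal dJ)
              (complexConj_imagUnit F) (imagUnit_ne_zero F) (imagUnit_mul_self F) (realDiagonal_isSymm F dJ hdJ)
              (isUnit_det_realDiagonal F dJ hdJ hdJ0) (realDiagonal_map F dJ hdJ).symm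
              (hsChiGS F finProdFinEquiv dJ hdJ hdJ0
                (toHeckeCharacter (F : Type) (galConj (IsCMField.complexConj (F : Type)) μ))
                (isUnitary_toHeckeCharacter (F : Type) (galConj (IsCMField.complexConj (F : Type)) μ))
                ((isOscillatorChar_toHeckeCharacter_iff (galConj (IsCMField.complexConj (F : Type)) μ)).mpr hμ.galConj))
              (r.toFun ε) χ).comp
              (finAdelicCongr ↥(maximalRealSubfield (F : Type)) (F : Type) (IsCMField.complexConj (F : Type)) gstar ht hg).symm.toMonoidHom)
            (rightRep₂ ↥(maximalRealSubfield (F : Type)) (F : Type) (IsCMField.complexConj (F : Type)) Jstar),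
          ∀ ψ : Representation.IntertwiningMap
            ((rhoVAtLine ↥(maximalRealSubfield (F : Type)) (F : Type) (IsCMField.complexConj (F : Type)) 2
              (finProdFinEquiv : Fin 2 × Fin 1 ≃ Fin (2 * 1)) (Matrix.diagonal dJ)
              (complexConj_imagUnit F) (imagUnit_ne_zero F) (imagUnit_mul_self F) (realDiagonal_isSymm F dJ hdJ)
              (isUnit_det_realDiagonal F dJ hdJ hdJ0) (realDiagonal_map F dJ hdJ).symm
              (hsChiGS F finProdFinEquiv dJ hdJ hdJ0
                (toHeckeCharacter (F : Type) (galConj (IsCMField.complexConj (F : Type)) μ))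
                (isUnitary_toHeckeCharacter (F : Type) (galConj (IsCMField.complexConj (F : Type)) μ))
                ((isOscillatorChar_toHeckeCharacter_iff (galConj (IsCMField.complexConj (F : Type)) μ)).mpr hμ.galConj))
              (r.toFun ε) χ).comp
              (finAdelicCongr ↥(maximalRealSubfield (F : Type)) (F : Type) (IsCMField.complexConj (F : Type)) gstar ht hg).symm.toMonoidHom)
            (rightRep₂ ↥(maximalRealSubfield (F : Type)) (F : Type) (IsCMField.complexConj (F : Type)) Jstar),
          (∀ w, ψ w ∈ cohForms₂ ↥(maximalRealSubfield (F : Type)) (F : Type) (IsCMField.complexConj (F : Type)) Jstar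
              (IsCMField.complexConj_ne_one (F : Type)) (UnitaryGroup.complexConj_smul_infinitePlace (F : Type))
              (cmPlace (F : Type) ι₁) 𝔣) → ∃ a : ℂ, ψ = a • ψ₀ :=
  s1MultOneForms_of_letters hE1 hE1'h hE1'a hE2' hDh
    (Literature.NumberTheory.Automorphic.UnitaryCurveForms.antiholCotFormSpectralProjection₂_of_hol hDh) hEh hEa

set_option synthInstance.maxHeartbeats 400000 in
set_option maxHeartbeats 4000000 in
/-- **HEAD″ (ed. 2) — `S1MultOneFormsShape` MODULO FIVE LETTERS {E1₂, E1′₂h, E2′₂θ, D₂h, E₂h}**: the three (0,1)-type letters are the conjugates of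
their (1,0) twins — E1′₂a by ★ `UnitaryCurveForms.curveCohFinComponentUnique_antihol_of_hol`, D₂a by ★ `antiholCotFormSpectralProjection₂_of_hol`,
E₂a by ★ `cohIsotypicLine₂_antihol_of_hol` (A-p06 (g18), p797687 ∕ p798131; the rank-2 twins of ★ `UnitaryGroupCotangentSpectralProjectionConj` ∕
★ `UnitaryGroupCohomologicalFormsConjRep`).  Same conclusion, token for token; the `n = 2` twin of ★ `F0P3HJ3aOfFiveLetters.hJ3a_of_five_letters`.
HC_CM is proved only modulo the 7 printed citations until rung 0 closes.
[cite: Liu2021, Prop. D.4 (1) and proof (p. 130–131)] [cite: Rogawski1990, §11.1 Prop. 11.1.1; Thm. 11.5.1; §12.3] [cite: BorelJacquet1979, §4.6]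
[cite: BorelWallach2000, VII 2.10, 3.2 and 3.6] -/
theorem s1MultOneForms_of_five_letters (hE1 : Literature.NumberTheory.Rogawski1990.curveMultiplicityLeOne)
    (hE1'h : Literature.NumberTheory.Rogawski1990.curveCohFinComponentUnique_hol)
    (hE2' : Literature.NumberTheory.Rogawski1990.curveThetaHodgeTypeRigid)
    (hDh : Literature.NumberTheory.Automorphic.UnitaryCurveForms.holCotFormSpectralProjection₂)
    (hEh : Literature.NumberTheory.Automorphic.UnitaryCurveForms.cohIsotypicLine₂_hol) :
      ∀ (F : CMField) [IsGalois ℚ F] (ι₁ : F →+* ℂ)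
        (μ : Literature.NumberTheory.Automorphic.IdeleClassGroup (F : Type) →ₜ* Circle)
        (hμ : IdeleClassGroup.IsConjugateSymplectic (F : Type) μ)
        (_hw : IdeleClassGroup.HasWeight (F : Type) μ 1)
        (Jstar : Matrix (Fin 2) (Fin 2) (F : Type)) (t : (F : Type)) (ht : t ≠ 0) (_hτt : 0 < (ι₁ t).re) (_hτt' : (ι₁ t).im = 0)
        (gstar : GL (Fin 2) (F : Type))
        (dJ : Fin 2 → (F : Type)) (hdJ : ∀ i, IsCMField.complexConj (F : Type) (dJ i) = dJ i) (hdJ0 : ∀ i, dJ i ≠ 0)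
        (hg : formCongr ((IsCMField.complexConj (F : Type) : (F : Type) ≃ₐ[↥(maximalRealSubfield (F : Type))] (F : Type)) :
            (F : Type) →+* (F : Type)) gstar (t • Jstar) = Matrix.diagonal dJ)
        (_hsig : (∃ Tstar : GL (Fin 2) ℂ,
            formCongr (starRingEnd ℂ) Tstar ((Matrix.diagonal dJ).map ι₁) = Matrix.diagonal ![(1 : ℂ), -1]) ∧
          ∀ τ' : (F : Type) →+* ℂ, InfinitePlace.mk τ' ≠ InfinitePlace.mk ι₁ → ((Matrix.diagonal dJ).map τ').PosDef)
        (h4 : 4 ≤ Module.finrank ℚ (F : Type))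
        (r : Rep ↥(maximalRealSubfield (F : Type)) (imagUnitSq F))
        (ε : Eps ↥(maximalRealSubfield (F : Type)) (imagUnitSq F))
        (_hadm : ∃ e : (F : Type), IsAdmissibleElement (F : Type) hμ.cmType.1 e ∧
          epsOf ↥(maximalRealSubfield (F : Type)) (imagUnitSq F) (F : Type) (2 * imagUnit (F : Type))⁻¹ (-e) = ε)
        (χ : Chi ↥(maximalRealSubfield (F : Type)) (F : Type) (IsCMField.complexConj (F : Type)))
        (𝔣 : ConeFrame (F : Type) Jstar (cmPlace (F : Type) ι₁)),
        ∃ ψ₀ : Representation.IntertwiningMap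
            ((rhoVAtLine ↥(maximalRealSubfield (F : Type)) (F : Type) (IsCMField.complexConj (F : Type)) 2
              (finProdFinEquiv : Fin 2 × Fin 1 ≃ Fin (2 * 1)) (Matrix.diagonal dJ)
              (complexConj_imagUnit F) (imagUnit_ne_zero F) (imagUnit_mul_self F) (realDiagonal_isSymm F dJ hdJ)
              (isUnit_det_realDiagonal F dJ hdJ hdJ0) (realDiagonal_map F dJ hdJ).symm
              (hsChiGS F finProdFinEquiv dJ hdJ hdJ0
                (toHeckeCharacter (F : Type) (galConj (IsCMField.complexConj (F : Type)) μ))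
                (isUnitary_toHeckeCharacter (F : Type) (galConj (IsCMField.complexConj (F : Type)) μ))
                ((isOscillatorChar_toHeckeCharacter_iff (galConj (IsCMField.complexConj (F : Type)) μ)).mpr hμ.galConj))
              (r.toFun ε) χ).comp
              (finAdelicCongr ↥(maximalRealSubfield (F : Type)) (F : Type) (IsCMField.complexConj (F : Type)) gstar ht hg).symm.toMonoidHom)
            (rightRep₂ ↥(maximalRealSubfield (F : Type)) (F : Type) (IsCMField.complexConj (F : Type)) Jstar),
          ∀ ψ : Representation.IntertwiningMap
            ((rhoVAtLine ↥(maximalRealSubfield (F : Type)) (F : Type) (IsCMField.complexConj (F : Type)) 2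
              (finProdFinEquiv : Fin 2 × Fin 1 ≃ Fin (2 * 1)) (Matrix.diagonal dJ)
              (complexConj_imagUnit F) (imagUnit_ne_zero F) (imagUnit_mul_self F) (realDiagonal_isSymm F dJ hdJ)
              (isUnit_det_realDiagonal F dJ hdJ hdJ0) (realDiagonal_map F dJ hdJ).symm
              (hsChiGS F finProdFinEquiv dJ hdJ hdJ0
                (toHeckeCharacter (F : Type) (galConj (IsCMField.complexConj (F : Type)) μ))
                (isUnitary_toHeckeCharacter (F : Type) (galConj (IsCMField.complexConj (F : Type)) μ))
                ((isOscillatorChar_toHeckeCharacter_iff (galConj (IsCMField.complexConj (F : Type)) μ)).mpr hμ.galConj))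
              (r.toFun ε) χ).comp
              (finAdelicCongr ↥(maximalRealSubfield (F : Type)) (F : Type) (IsCMField.complexConj (F : Type)) gstar ht hg).symm.toMonoidHom)
            (rightRep₂ ↥(maximalRealSubfield (F : Type)) (F : Type) (IsCMField.complexConj (F : Type)) Jstar),
          (∀ w, ψ w ∈ cohForms₂ ↥(maximalRealSubfield (F : Type)) (F : Type) (IsCMField.complexConj (F : Type)) Jstar
              (IsCMField.complexConj_ne_one (F : Type)) (UnitaryGroup.complexConj_smul_infinitePlace (F : Type))
              (cmPlace (F : Type) ι₁) 𝔣) → ∃ a : ℂ, ψ = a • ψ₀ :=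
  s1MultOneForms_of_letters hE1 hE1'h (Literature.NumberTheory.Automorphic.UnitaryCurveForms.curveCohFinComponentUnique_antihol_of_hol hE1'h)
    hE2' hDh (Literature.NumberTheory.Automorphic.UnitaryCurveForms.antiholCotFormSpectralProjection₂_of_hol hDh) hEh
    (Literature.NumberTheory.Automorphic.UnitaryCurveForms.cohIsotypicLine₂_antihol_of_hol hEh)

end Summit.HodgeConjecture.HodgeConjecture.Cruxes.HLiu418.S1MultOneFormsOfLetters

end
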